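import Literature.InformationTheory.Entropy.ConditionalMinEntropyBounds
import HarnessLib

/-!
# Leftover hashing against quantum side information, I: trace norm, sign operator and the
# weighted Cauchy–Schwarz step (Tomamichel–Schaffner–Smith–Renner 2011, Lemma 4)

Topic `InformationTheory/Entropy`, namespace `Literature.InformationTheory.Entropy`, sub-namespace
`QuantumLeftoverHash`. First of three files (`…Toolkit` → `…Collision` → `QuantumLeftoverHashing`)
formalizing the Leftover Hash Lemma against quantum side information,
[cite: TomamichelEtAl2010, Theorem 6] at `ε = 0` (= [cite: Renner2005, Corollary 5.5.2], the `ε = 0`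
form), over the
tree's cq-state vocabulary `Literature.InformationTheory.Entropy.{guessProb, condMinEntropy}`
(`ConditionalMinEntropy.lean`; `ConditionalMinEntropyBounds.lean` for `cqMap`). Everything here is
PROVED; no named fact, no `sorry`.

Source read on the page (held text `paper:arxiv-1002.2436`, chunks p0007–p0010): §2 (trace
distance `½‖ρ − τ‖₁ = ½ tr|ρ − τ|`, Definition 2: `Γ_C(ρ_AB|σ_B) := tr((ρ_AB (1 ⊗ σ_B^{-1/2}))²)`),
§3 Lemma 4 (proof: Hölder with `r = t = 4`, `s = 2`, `A = C = 1 ⊗ τ^{1/4}`,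
`B = (1 ⊗ τ^{-1/4})(ρ_AB − ω_A ⊗ ρ_B)(1 ⊗ τ^{-1/4})`, giving
`‖ρ_AB − ω_A ⊗ ρ_B‖₁ ≤ √(d_A · tr((ρ_AB − ω_A ⊗ ρ_B)(1 ⊗ τ^{-1/2}))²)`).

DESIGN. To stay inside elementary matrix algebra (no `τ^{±1/4}`), the Hölder step is carried out
ENTRYWISE in an orthonormal eigenbasis `V` of the weighting operator `τ`: with positive weights
`w_i` (later `w_i = √(λ_i(ρ_E) + η)`) and `W = diag(1/w)`, the weighted Hilbert–Schmidt form
`B_w(T, U) := Re tr(Tᴴ W U W)` (`wform`) has diagonal `B_w(T,T) = Σ_{ij} |T_ij|²/(w_i w_j)` =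
`tr(T τ^{-1/2} T τ^{-1/2})` in that basis, and for any `Λ` with `ΛΛ* = Λ*Λ = 1`,
`Re tr(ΛS) ≤ √(Σ_i w_i²) · √(B_w(V*SV, V*SV))` (`re_trace_mul_le_sqrt_wform`; Cauchy–Schwarz on
the entries plus `2 w_i w_j ≤ w_i² + w_j²` and the unit row/column sums of `V*ΛV`). With `Λ` the
SIGN OPERATOR of a Hermitian `S` (`exists_signOp`: `Re tr(ΛS) = Σ_i |λ_i(S)| = ‖S‖₁`) this is
exactly Lemma 4's `‖S‖₁ ≤ √(tr τ) · √(tr(S τ^{-1/2} S τ^{-1/2}))`. The trace norm `trNorm S` is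
`Σ_i |λ_i(S)|` for Hermitian `S` (the tree's convention, cf.
`Literature.InformationTheory.StateDiscrimination.TraceDistanceContraction.traceDistance_kraus_le`),
set to `0` on non-Hermitian input (never used). §3: bilinearity of `B_w` and positivity on pairs of
positive operators («the trace terms are positive», [cite: TomamichelEtAl2010, Lemma 5 (proof)]).

HONEST FRAMING. Matrix-analysis toolkit for an extractor theorem; nothing here models a protocol,
an adversary or a device, and nothing here proves or refutes any quantum-advantage claim.
-/

namespace Literature.InformationTheory.Entropy

open Matrix
open scoped ComplexOrder MatrixOrder
open Literature.LinearAlgebra.Matrix.NearestPositiveSemidefinite (re_trace_mul_nonneg)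

namespace QuantumLeftoverHash

variable {e : Type*} [Fintype e] [DecidableEq e]

/-! ### §1 The trace norm of a Hermitian matrix and its sign operator -/

/-- The **trace norm** `‖S‖₁ = tr|S| = Σ_i |λ_i(S)|` of a Hermitian matrix `S` (sum of the
absolute values of its eigenvalues); set to `0` on non-Hermitian input (never used). The trace
distance of two states is `½‖ρ − τ‖₁`.
[cite: TomamichelEtAl2010, §2 (trace distance `½‖ρ − τ‖₁ = ½ tr|ρ − τ|`)] -/
noncomputable def trNorm (S : Matrix e e ℂ) : ℝ :=
  if h : S.IsHermitian then ∑ i, |h.eigenvalues i| else 0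

/-- Unfolding: for Hermitian `S`, `‖S‖₁ = Σ_i |λ_i(S)|`. [cite: TomamichelEtAl2010, §2] -/
theorem trNorm_of_isHermitian {S : Matrix e e ℂ} (hS : S.IsHermitian) :
    trNorm S = ∑ i, |hS.eigenvalues i| := by
  rw [trNorm, dif_pos hS]

/-- `0 ≤ ‖S‖₁`. [cite: TomamichelEtAl2010, §2 (trace norm `tr|ρ − τ|`)] -/
theorem trNorm_nonneg (S : Matrix e e ℂ) : 0 ≤ trNorm S := by
  unfold trNorm
  split_ifs with h
  · exact Finset.sum_nonneg fun i _ => abs_nonneg _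
  · exact le_rfl

/-- `Re tr(diagonal d · A) = Σ_i Re(d_i · A_ii)` (plumbing).
[cite: TomamichelEtAl2010, Lemma 4 (proof; plumbing for the Hölder/Cauchy–Schwarz step)] -/
theorem re_trace_diagonal_mul (d : e → ℂ) (A : Matrix e e ℂ) :
    ((diagonal d * A).trace).re = ∑ i, (d i * A i i).re := by
  rw [trace, Complex.re_sum]
  refine Finset.sum_congr rfl fun i _ => ?_
  rw [diag_apply, diagonal_mul]

/-- **Sign operator.** For a Hermitian `S = V·diag(λ)·V*` the Hermitian unitary
`Λ = V·diag(sgn λ)·V*` (`sgn 0 := 1`) satisfies `ΛΛ* = Λ*Λ = 1` and `Re tr(Λ S) = Σ_i |λ_i| = ‖S‖₁`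
(the variational formula `‖S‖₁ = max_{‖Λ‖ ≤ 1} Re tr(ΛS)`, attained at the sign of `S`).
[cite: NielsenChuang2010, §9.2.1 (`D(ρ,σ) = max_P tr(P(ρ − σ))`, attained at the positive-part
projector)] -/
theorem exists_signOp {S : Matrix e e ℂ} (hS : S.IsHermitian) :
    ∃ Λ : Matrix e e ℂ, Λ * Λᴴ = 1 ∧ Λᴴ * Λ = 1 ∧ ((Λ * S).trace).re = trNorm S := by
  have hSeq := hS.spectral_theorem
  rw [Unitary.conjStarAlgAut_apply] at hSeq
  set V : Matrix e e ℂ := (hS.eigenvectorUnitary : Matrix e e ℂ) with hVdef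
  have hVV : star V * V = 1 := Unitary.coe_star_mul_self hS.eigenvectorUnitary
  have hVV' : V * star V = 1 := Unitary.coe_mul_star_self hS.eigenvectorUnitary
  set D : Matrix e e ℂ := diagonal (RCLike.ofReal ∘ hS.eigenvalues) with hD
  -- the sign pattern
  set s : e → ℂ := fun i => if 0 ≤ hS.eigenvalues i then 1 else -1 with hs
  have hss : ∀ i, s i * s i = 1 := by
    intro i; simp only [hs]; split_ifs <;> norm_num
  have hsstar : ∀ i, star (s i) = s i := by
    intro i; simp only [hs]; split_ifs <;> simp
  have hDs : (diagonal s)ᴴ = diagonal s := by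
    rw [diagonal_conjTranspose]
    exact congrArg diagonal (funext hsstar)
  -- `Λ := V diag(s) V*` is Hermitian and squares to `1`
  have hΛh : (V * diagonal s * star V)ᴴ = V * diagonal s * star V := by
    rw [conjTranspose_mul, conjTranspose_mul, hDs, star_eq_conjTranspose,
      conjTranspose_conjTranspose, Matrix.mul_assoc]
  have hΛsq : V * diagonal s * star V * (V * diagonal s * star V) = 1 := by
    calc V * diagonal s * star V * (V * diagonal s * star V)
        = V * diagonal s * (star V * V) * diagonal s * star V := by
          simp only [Matrix.mul_assoc]
      _ = V * (diagonal s * diagonal s) * star V := by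
          rw [hVV, Matrix.mul_one, Matrix.mul_assoc V]
      _ = 1 := by
          rw [diagonal_mul_diagonal, show (fun i => s i * s i) = fun _ => (1 : ℂ) from funext hss,
            diagonal_one, Matrix.mul_one, hVV']
  refine ⟨V * diagonal s * star V, by rw [hΛh, hΛsq], by rw [hΛh, hΛsq], ?_⟩
  -- `tr(Λ S) = tr(V diag(s) V* V D V*) = tr(diag(s) D) = Σ_i s_i λ_i = Σ_i |λ_i|`
  have htr : (V * diagonal s * star V * S).trace = (diagonal s * D).trace := by
    rw [hSeq]
    have : V * diagonal s * star V * (V * D * star V) = V * (diagonal s * D) * star V := by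
      calc V * diagonal s * star V * (V * D * star V)
          = V * diagonal s * (star V * V) * D * star V := by simp only [Matrix.mul_assoc]
        _ = V * (diagonal s * D) * star V := by rw [hVV, Matrix.mul_one, Matrix.mul_assoc V]
    rw [this, Matrix.trace_mul_cycle, hVV, Matrix.one_mul]
  have hD' : D = diagonal (fun i => ((hS.eigenvalues i : ℝ) : ℂ)) := by rw [hD]; rfl
  rw [trNorm_of_isHermitian hS, htr, hD', re_trace_diagonal_mul]
  refine Finset.sum_congr rfl fun i _ => ?_
  rw [diagonal_apply_eq]
  simp only [hs]
  split_ifs with hpos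
  · rw [one_mul, Complex.ofReal_re, abs_of_nonneg hpos]
  · rw [neg_one_mul, Complex.neg_re, Complex.ofReal_re, abs_of_neg (not_le.1 hpos)]

/-! ### §2 A weighted Hilbert–Schmidt form and the weighted Cauchy–Schwarz step

For positive weights `w : e → ℝ` put `W := diag(1/w)`. The real bilinear form
`B_w(T, U) := Re tr(Tᴴ W U W) = Σ_{i,j} Re(conj(T_ij) U_ij)/(w_i w_j)` is the Hilbert–Schmidt form
weighted by `W ⊗ W`; for `W = τ^{-1/2}` in an eigenbasis of `τ` its diagonal `B_w(T, T)` is the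
summand `tr(T τ^{-1/2} T τ^{-1/2})` of the conditional collision entropy
[cite: TomamichelEtAl2010, Definition 2]. The step `‖S‖₁ ≤ √(tr τ) · √(tr(S τ^{-1/2} S τ^{-1/2}))`
of [cite: TomamichelEtAl2010, Lemma 4 (proof, Hölder with `r = t = 4`, `s = 2`)] is proved here
ENTRYWISE in an eigenbasis `V` of `τ` (so that `τ^{±1/2}`, `τ^{±1/4}` are honest real diagonals):
`Re tr(ΛS) ≤ √(Σ_i w_i²) · √(B_w(V*SV, V*SV))` for every `Λ` with `ΛΛ* = Λ*Λ = 1`. -/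

/-- The diagonal of inverse weights `W = diag(1/w_i)` (as a complex matrix). [folklore] -/
noncomputable def winv (w : e → ℝ) : Matrix e e ℂ := diagonal fun i => (((w i)⁻¹ : ℝ) : ℂ)

omit [Fintype e] in
/-- `W` is Hermitian (real diagonal).
[cite: TomamichelEtAl2010, Lemma 4 (proof; plumbing for the Hölder/Cauchy–Schwarz step)] -/
theorem winv_conjTranspose (w : e → ℝ) : (winv w)ᴴ = winv w := by
  rw [winv, diagonal_conjTranspose]
  congr 1
  funext i
  exact Complex.conj_ofReal _

/-- The **weighted Hilbert–Schmidt form** `B_w(T, U) := Re tr(Tᴴ · W · U · W)`, `W = diag(1/w)`.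
[cite: TomamichelEtAl2010, Definition 2 (the trace `tr(ρ σ^{-1/2} ρ σ^{-1/2})`)] -/
noncomputable def wform (w : e → ℝ) (T U : Matrix e e ℂ) : ℝ :=
  ((Tᴴ * winv w * U * winv w).trace).re

/-- Entrywise: `tr(Tᴴ W U W) = Σ_i Σ_j conj(T_ij) · U_ij · (w_i⁻¹ w_j⁻¹)`.
[cite: TomamichelEtAl2010, Lemma 4 (proof; plumbing for the Hölder/Cauchy–Schwarz step)] -/
theorem trace_wform_eq_sum (w : e → ℝ) (T U : Matrix e e ℂ) :
    (Tᴴ * winv w * U * winv w).trace =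
      ∑ i, ∑ j, star (T i j) * U i j * ((((w i)⁻¹ * (w j)⁻¹ : ℝ)) : ℂ) := by
  rw [trace, Finset.sum_comm]
  refine Finset.sum_congr rfl fun j _ => ?_
  rw [diag_apply, winv, mul_diagonal, Matrix.mul_apply, Finset.sum_mul]
  refine Finset.sum_congr rfl fun i _ => ?_
  rw [mul_diagonal, conjTranspose_apply, Complex.ofReal_mul]
  ring

/-- The diagonal of the weighted form: `B_w(T, T) = Σ_i Σ_j ‖T_ij‖² / (w_i w_j)`
(= `Γ_C` summand in the eigenbasis). [cite: TomamichelEtAl2010, Definition 2] -/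
theorem wform_self_eq_sum (w : e → ℝ) (T : Matrix e e ℂ) :
    wform w T T = ∑ i, ∑ j, ‖T i j‖ ^ 2 / (w i * w j) := by
  rw [wform, trace_wform_eq_sum, Complex.re_sum]
  refine Finset.sum_congr rfl fun i _ => ?_
  rw [Complex.re_sum]
  refine Finset.sum_congr rfl fun j _ => ?_
  rw [Complex.star_def, ← Complex.normSq_eq_conj_mul_self, ← Complex.ofReal_mul, Complex.ofReal_re,
    Complex.normSq_eq_norm_sq, div_eq_mul_inv, mul_inv]

/-- Row sums of a co-isometry: `Λ Λᴴ = 1 ⇒ Σ_j ‖Λ_ij‖² = 1`.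
[cite: TomamichelEtAl2010, Lemma 4 (proof; plumbing for the Hölder/Cauchy–Schwarz step)] -/
theorem sum_norm_sq_row_eq_one {Λ : Matrix e e ℂ} (hΛ : Λ * Λᴴ = 1) (i : e) :
    ∑ j, ‖Λ i j‖ ^ 2 = 1 := by
  have h := congrFun (congrFun hΛ i) i
  rw [Matrix.mul_apply, Matrix.one_apply_eq] at h
  have h' : ∑ j, ((‖Λ i j‖ ^ 2 : ℝ) : ℂ) = 1 := by
    rw [← h]
    refine Finset.sum_congr rfl fun j _ => ?_
    rw [conjTranspose_apply, Complex.star_def, Complex.mul_conj, Complex.normSq_eq_norm_sq]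
  exact_mod_cast h'

/-- Column sums of an isometry: `Λᴴ Λ = 1 ⇒ Σ_i ‖Λ_ij‖² = 1`.
[cite: TomamichelEtAl2010, Lemma 4 (proof; plumbing for the Hölder/Cauchy–Schwarz step)] -/
theorem sum_norm_sq_col_eq_one {Λ : Matrix e e ℂ} (hΛ : Λᴴ * Λ = 1) (j : e) :
    ∑ i, ‖Λ i j‖ ^ 2 = 1 := by
  have h := congrFun (congrFun hΛ j) j
  rw [Matrix.mul_apply, Matrix.one_apply_eq] at h
  have h' : ∑ i, ((‖Λ i j‖ ^ 2 : ℝ) : ℂ) = 1 := by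
    rw [← h]
    refine Finset.sum_congr rfl fun i _ => ?_
    rw [conjTranspose_apply, Complex.star_def, ← Complex.normSq_eq_conj_mul_self,
      Complex.normSq_eq_norm_sq]
  exact_mod_cast h'

omit [DecidableEq e] in
/-- `Re tr(Λ S) ≤ Σ_i Σ_j ‖Λ_ij‖ · ‖S_ji‖`.
[cite: TomamichelEtAl2010, Lemma 4 (proof; plumbing for the Hölder/Cauchy–Schwarz step)] -/
theorem re_trace_mul_le_sum_norm (Λ S : Matrix e e ℂ) :
    ((Λ * S).trace).re ≤ ∑ i, ∑ j, ‖Λ i j‖ * ‖S j i‖ := by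
  rw [trace, Complex.re_sum]
  refine Finset.sum_le_sum fun i _ => ?_
  rw [diag_apply, Matrix.mul_apply, Complex.re_sum]
  refine Finset.sum_le_sum fun j _ => ?_
  exact (Complex.re_le_norm _).trans (norm_mul_le _ _)

/-- **Weighted Cauchy–Schwarz for the trace norm (entrywise form of TSSR11 Lemma 4's Hölder
step).** For a unitary `V`, a `Λ` with `ΛΛ* = Λ*Λ = 1`, positive weights `w` and any `S`:
`Re tr(Λ S) ≤ √(Σ_i w_i²) · √(B_w(V*SV, V*SV))`. With `Λ` the sign of a Hermitian `S`, `V`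
an eigenbasis of `τ` and `w_i = √(λ_i(τ))` this reads
`‖S‖₁ ≤ √(tr τ) · √(tr(S τ^{-1/2} S τ^{-1/2}))`.
[cite: TomamichelEtAl2010, Lemma 4 (proof)] -/
theorem re_trace_mul_le_sqrt_wform {V Λ S : Matrix e e ℂ} (hV : Vᴴ * V = 1) (hV' : V * Vᴴ = 1)
    (hΛ : Λ * Λᴴ = 1) (hΛ' : Λᴴ * Λ = 1) {w : e → ℝ} (hw : ∀ i, 0 < w i) :
    ((Λ * S).trace).re ≤
      Real.sqrt (∑ i, w i ^ 2) * Real.sqrt (wform w (Vᴴ * S * V) (Vᴴ * S * V)) := by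
  -- rotate: `tr(Λ S) = tr(Λ' S')` with `Λ' = V*ΛV`, `S' = V*SV`
  set Λ' : Matrix e e ℂ := Vᴴ * Λ * V with hΛ'def
  set S' : Matrix e e ℂ := Vᴴ * S * V with hS'def
  have hrot : (Λ * S).trace = (Λ' * S').trace := by
    have : Λ' * S' = Vᴴ * (Λ * S) * V := by
      calc Λ' * S' = Vᴴ * Λ * (V * Vᴴ) * S * V := by simp only [hΛ'def, hS'def, Matrix.mul_assoc]
        _ = Vᴴ * (Λ * S) * V := by rw [hV', Matrix.mul_one, Matrix.mul_assoc Vᴴ]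
    rw [this, Matrix.trace_mul_cycle, hV', Matrix.one_mul]
  have hΛ'1 : Λ' * Λ'ᴴ = 1 := by
    calc Λ' * Λ'ᴴ = Vᴴ * Λ * (V * Vᴴ) * Λᴴ * Vᴴᴴ := by
          simp only [hΛ'def, conjTranspose_mul, Matrix.mul_assoc]
      _ = 1 := by rw [hV', Matrix.mul_one, conjTranspose_conjTranspose, Matrix.mul_assoc Vᴴ, hΛ,
          Matrix.mul_one, hV]
  have hΛ'2 : Λ'ᴴ * Λ' = 1 := by
    calc Λ'ᴴ * Λ' = Vᴴ * Λᴴ * (Vᴴᴴ * Vᴴ) * Λ * V := by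
          simp only [hΛ'def, conjTranspose_mul, Matrix.mul_assoc]
      _ = 1 := by rw [conjTranspose_conjTranspose, hV', Matrix.mul_one, Matrix.mul_assoc Vᴴ, hΛ',
          Matrix.mul_one, hV]
  rw [hrot]
  -- entrywise Cauchy–Schwarz with the split `‖Λ'_ij‖√(w_i w_j) · ‖S'_ji‖/√(w_i w_j)`
  have hw0 : ∀ i, w i ≠ 0 := fun i => (hw i).ne'
  set r : e × e → ℝ := fun p => ‖Λ' p.1 p.2‖ * ‖S' p.2 p.1‖ with hr
  set f : e × e → ℝ := fun p => ‖Λ' p.1 p.2‖ ^ 2 * (w p.1 * w p.2) with hf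
  set g : e × e → ℝ := fun p => ‖S' p.2 p.1‖ ^ 2 / (w p.1 * w p.2) with hg
  have hstep1 : ((Λ' * S').trace).re ≤ ∑ p : e × e, r p := by
    rw [Fintype.sum_prod_type]
    exact re_trace_mul_le_sum_norm Λ' S'
  have hCS : (∑ p : e × e, r p) ^ 2 ≤ (∑ p : e × e, f p) * ∑ p : e × e, g p :=
    Finset.sum_sq_le_sum_mul_sum_of_sq_le_mul _
      (fun p _ => mul_nonneg (sq_nonneg _) (mul_pos (hw _) (hw _)).le)
      (fun p _ => div_nonneg (sq_nonneg _) (mul_pos (hw _) (hw _)).le)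
      (fun p _ => by
        simp only [hr, hf, hg]
        rw [mul_pow, mul_assoc, ← mul_div_assoc,
          mul_div_cancel_left₀ _ (mul_ne_zero (hw0 _) (hw0 _))])
  -- `Σ f ≤ Σ_i w_i²` by `2 w_i w_j ≤ w_i² + w_j²` and the unit row/column sums of `Λ'`
  have hf_le : ∑ p : e × e, f p ≤ ∑ i, w i ^ 2 := by
    have hfg : ∀ p : e × e,
        f p ≤ ‖Λ' p.1 p.2‖ ^ 2 * w p.1 ^ 2 / 2 + ‖Λ' p.1 p.2‖ ^ 2 * w p.2 ^ 2 / 2 := fun p => by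
        simp only [hf]
        nlinarith [two_mul_le_add_sq (w p.1) (w p.2), sq_nonneg ‖Λ' p.1 p.2‖]
    calc ∑ p : e × e, f p
        ≤ ∑ p : e × e, (‖Λ' p.1 p.2‖ ^ 2 * w p.1 ^ 2 / 2 + ‖Λ' p.1 p.2‖ ^ 2 * w p.2 ^ 2 / 2) :=
          Finset.sum_le_sum fun p _ => hfg p
      _ = (∑ i, w i ^ 2 * (∑ j, ‖Λ' i j‖ ^ 2)) / 2 + (∑ j, w j ^ 2 * (∑ i, ‖Λ' i j‖ ^ 2)) / 2 := by
          rw [Finset.sum_add_distrib, Fintype.sum_prod_type, Fintype.sum_prod_type_right]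
          congr 1
          · rw [Finset.sum_div]
            refine Finset.sum_congr rfl fun i _ => ?_
            rw [Finset.mul_sum, Finset.sum_div]
            refine Finset.sum_congr rfl fun j _ => ?_
            ring
          · rw [Finset.sum_div]
            refine Finset.sum_congr rfl fun j _ => ?_
            rw [Finset.mul_sum, Finset.sum_div]
            refine Finset.sum_congr rfl fun i _ => ?_
            ring
      _ = ∑ i, w i ^ 2 := by
          simp only [sum_norm_sq_row_eq_one hΛ'1, sum_norm_sq_col_eq_one hΛ'2, mul_one]
          ring
  have hg_eq : ∑ p : e × e, g p = wform w S' S' := by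
    rw [wform_self_eq_sum, Fintype.sum_prod_type, Finset.sum_comm]
    refine Finset.sum_congr rfl fun j _ => Finset.sum_congr rfl fun i _ => ?_
    simp only [hg]
    rw [mul_comm (w i)]
  -- assemble
  have hr0 : 0 ≤ ∑ p : e × e, r p := Finset.sum_nonneg fun p _ => by positivity
  have hf0 : 0 ≤ ∑ p : e × e, f p :=
    Finset.sum_nonneg fun p _ => mul_nonneg (sq_nonneg _) (mul_pos (hw _) (hw _)).le
  calc ((Λ' * S').trace).re ≤ ∑ p : e × e, r p := hstep1
    _ ≤ Real.sqrt ((∑ p : e × e, f p) * ∑ p : e × e, g p) := Real.le_sqrt_of_sq_le hCS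
    _ = Real.sqrt (∑ p : e × e, f p) * Real.sqrt (∑ p : e × e, g p) := Real.sqrt_mul hf0 _
    _ ≤ Real.sqrt (∑ i, w i ^ 2) * Real.sqrt (wform w S' S') := by
          rw [hg_eq]
          exact mul_le_mul_of_nonneg_right (Real.sqrt_le_sqrt hf_le) (Real.sqrt_nonneg _)

/-! ### §3 Bilinearity of the weighted form; positivity on positive pairs -/

/-- `B_w` is additive on the left.
[cite: TomamichelEtAl2010, Lemma 4–5 (proofs; expansion of the squared deviation — plumbing)] -/
theorem wform_sub_left (w : e → ℝ) (T₁ T₂ U : Matrix e e ℂ) :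
    wform w (T₁ - T₂) U = wform w T₁ U - wform w T₂ U := by
  simp only [wform, conjTranspose_sub, Matrix.sub_mul, trace_sub, Complex.sub_re]

/-- `B_w` is additive on the right.
[cite: TomamichelEtAl2010, Lemma 4–5 (proofs; expansion of the squared deviation — plumbing)] -/
theorem wform_sub_right (w : e → ℝ) (T U₁ U₂ : Matrix e e ℂ) :
    wform w T (U₁ - U₂) = wform w T U₁ - wform w T U₂ := by
  simp only [wform, Matrix.mul_sub, Matrix.sub_mul, trace_sub, Complex.sub_re]

/-- `B_w(c·T, U) = c·B_w(T, U)` for real `c`.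
[cite: TomamichelEtAl2010, Lemma 4–5 (proofs; expansion of the squared deviation — plumbing)] -/
theorem wform_smul_left (w : e → ℝ) (c : ℝ) (T U : Matrix e e ℂ) :
    wform w ((c : ℂ) • T) U = c * wform w T U := by
  rw [wform, wform, conjTranspose_smul, Complex.star_def, Complex.conj_ofReal, smul_mul_assoc,
    smul_mul_assoc, smul_mul_assoc, trace_smul, smul_eq_mul, Complex.re_ofReal_mul]

/-- `B_w(T, c·U) = c·B_w(T, U)` for real `c`.
[cite: TomamichelEtAl2010, Lemma 4–5 (proofs; expansion of the squared deviation — plumbing)] -/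
theorem wform_smul_right (w : e → ℝ) (c : ℝ) (T U : Matrix e e ℂ) :
    wform w T ((c : ℂ) • U) = c * wform w T U := by
  rw [wform, wform, mul_smul_comm, smul_mul_assoc, trace_smul, smul_eq_mul, Complex.re_ofReal_mul]

/-- `B_w(Σ_i T_i, U) = Σ_i B_w(T_i, U)`.
[cite: TomamichelEtAl2010, Lemma 4–5 (proofs; expansion of the squared deviation — plumbing)] -/
theorem wform_sum_left {ι : Type*} (s : Finset ι) (w : e → ℝ) (T : ι → Matrix e e ℂ)
    (U : Matrix e e ℂ) : wform w (∑ i ∈ s, T i) U = ∑ i ∈ s, wform w (T i) U := by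
  simp only [wform, conjTranspose_sum, Finset.sum_mul, trace_sum, Complex.re_sum]

/-- `B_w(T, Σ_i U_i) = Σ_i B_w(T, U_i)`.
[cite: TomamichelEtAl2010, Lemma 4–5 (proofs; expansion of the squared deviation — plumbing)] -/
theorem wform_sum_right {ι : Type*} (s : Finset ι) (w : e → ℝ) (T : Matrix e e ℂ)
    (U : ι → Matrix e e ℂ) : wform w T (∑ i ∈ s, U i) = ∑ i ∈ s, wform w T (U i) := by
  simp only [wform, Finset.mul_sum, Finset.sum_mul, trace_sum, Complex.re_sum]

/-- `B_w(Σ_i T_i, Σ_j T_j) = Σ_i Σ_j B_w(T_i, T_j)`.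
[cite: TomamichelEtAl2010, Lemma 4–5 (proofs; expansion of the squared deviation — plumbing)] -/
theorem wform_sum_sum {ι : Type*} (s : Finset ι) (w : e → ℝ) (T : ι → Matrix e e ℂ) :
    wform w (∑ i ∈ s, T i) (∑ j ∈ s, T j) = ∑ i ∈ s, ∑ j ∈ s, wform w (T i) (T j) := by
  rw [wform_sum_left]
  exact Finset.sum_congr rfl fun i _ => wform_sum_right s w (T i) T

/-- **Positivity of the cross terms** («the trace terms are positive»,
[cite: TomamichelEtAl2010, Lemma 5 (proof)]): for positive semidefinite `P, Q`,
`B_w(P, Q) = Re tr(P · (W Q W)) ≥ 0` (trace of a product of two positive operators). -/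
theorem wform_nonneg_of_posSemidef (w : e → ℝ) {P Q : Matrix e e ℂ} (hP : P.PosSemidef)
    (hQ : Q.PosSemidef) : 0 ≤ wform w P Q := by
  have hW : (winv w * Q * winv w).PosSemidef := by
    have h := hQ.mul_mul_conjTranspose_same (winv w)
    rwa [winv_conjTranspose] at h
  have h := re_trace_mul_nonneg hP hW
  rw [wform, hP.1.eq]
  simpa only [Matrix.mul_assoc, RCLike.re_to_complex] using h


end QuantumLeftoverHash

end Literature.InformationTheory.Entropy
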